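import Summits.QuantumFields.YangMills.Theorems.ColdStartUniversalityLatticeLangevinSynchronousCoupling
import HarnessLib

/-!
# Route `ColdStartUniversality` (fixed-cut-off SZZ dynamics; conjugation calculus):
# ★★ PATHWISE SYNCHRONOUS COUPLING IN THE COUPLING CONSTANT — two SZZ flows at `β₁, β₂` driven by the same noise

Helper file (seat `ym-line-csu-p1`, g33, file 64).  Companion of `synchronous_coupling_hsDist_le` (g23: two STARTS, one
coupling).  Here: ONE start `x`, TWO couplings.  For two regular solution families `U¹ = U true` (coupling `β true`) and
`U⁰ = U false` (coupling `β false`) of the SU(2) lattice Langevin dynamics on `(ℤ/L)³` driven by the SAME flat noise, the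
pathwise conjugation identity (`reIm_conjProduct_pair_eq_add_integral`) makes `V_e = (ρU⁰_e)ᴴ ρU¹_e` a `C¹` path with
`‖V̇_e‖_F = ‖(D_{β₁}(U¹)_e − D_{β₂}(U⁰)_e) ρU¹_e‖_F`; splitting `D_{β₁}(U¹) − D_{β₂}(U⁰) = (D_{β₁}(U¹) − D_{β₁}(U⁰)) + (β₁ − β₂)·D₁(U⁰)`
(the drift is LINEAR in `β`, `driftLie_sub_driftLie`) and Grönwall give the SURE estimate

  `Σ_e ‖ρU¹_e(t) − ρU⁰_e(t)‖_F² ≤ C · (β₁ − β₂)² · (e^{K t} − 1)`   almost surely, for ALL `t ≥ 0`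

(`synchronous_coupling_beta_hsDist_le`; `K = 1 + 2K₀(L, β₁)` with `K₀` from `exists_lipschitz_driftDiff`, `C = 2C₁/K` with
`C₁ = sup_V Σ_e ‖D₁(V)_e‖_F²` from compactness, `exists_bound_sum_hsForm_driftLie_one`).  Ingredients:
`hsForm_mul_right_of_mul_conjTranspose_eq_one` (unitary invariance on the right), `hsForm_add_self_le`.
THEOREMS ONLY, no sorry.  HONEST FRAMING: fixed cut-off; `K, C` depend on `L` and the couplings (no uniformity in the volume or
in `t` is claimed — the bound grows like `e^{Kt}`); no crux, rung or summit statement is proved or restated; the Yang–Mills mass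
gap is NOT proved.
-/

set_option autoImplicit false

noncomputable section

namespace Summit.QuantumFields.YangMills.Theorems.ColdStartUniversality

open MeasureTheory ProbabilityTheory Finset Filter
open scoped NNReal Matrix ComplexConjugate Topology Matrix.Norms.Frobenius
open Literature.Probability.Process Literature.MathematicalPhysics.QuantumFieldTheory
open Literature.MathematicalPhysics.QuantumLattice (fundamentalRep fundamentalLatticeRep continuous_fundamentalRep
  fundamentalRep_mem_unitaryGroup)

variable {L : ℕ}

/-! ## Hilbert–Schmidt algebra -/

/-- **Unitary invariance on the right**: `‖Y W‖_F = ‖Y‖_F` when `W Wᴴ = 1`. [folklore] -/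
theorem hsForm_mul_right_of_mul_conjTranspose_eq_one {N : ℕ} {W : Matrix (Fin N) (Fin N) ℂ} (hW : W * Wᴴ = 1)
    (Y : Matrix (Fin N) (Fin N) ℂ) : hsForm N (Y * W) (Y * W) = hsForm N Y Y := by
  rw [hsForm_apply, hsForm_apply, Matrix.conjTranspose_mul, Matrix.mul_assoc, ← Matrix.mul_assoc W, hW, Matrix.one_mul]

/-- `‖X + Y‖² ≤ 2‖X‖² + 2‖Y‖²`. [folklore] -/
theorem hsForm_add_self_le {N : ℕ} (X Y : Matrix (Fin N) (Fin N) ℂ) :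
    hsForm N (X + Y) (X + Y) ≤ 2 * hsForm N X X + 2 * hsForm N Y Y := by
  have h := two_mul_abs_hsForm_le X Y
  have e2 : hsForm N (X + Y) (X + Y) = hsForm N X X + 2 * hsForm N X Y + hsForm N Y Y := by
    simp only [map_add, LinearMap.add_apply, hsForm_comm Y X]; ring
  rw [e2]
  linarith [le_abs_self (hsForm N X Y)]

/-! ## The drift is linear in the coupling -/

/-- **Linearity of the Lie-algebra drift in `β`**: `D_{β₁}(Q)_e − D_{β₂}(Q)_e = (β₁ − β₂) · D₁(Q)_e`. [folklore] -/
theorem driftLie_sub_driftLie (β₁ β₂ : ℝ) (Q : MatrixConfig 3 L (fundamentalLatticeRep 2).N) (e : Edge 3 L) :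
    (fundamentalLatticeRep 2).driftLie β₁ Q e - (fundamentalLatticeRep 2).driftLie β₂ Q e =
      (β₁ - β₂) • (fundamentalLatticeRep 2).driftLie 1 Q e := by
  simp only [LatticeRep.driftLie, one_smul, sub_smul]

/-- **Uniform bound for the `β`-slope of the drift**: `Σ_e ‖D₁(V)_e‖_F² ≤ C₁` for all configurations `V ∈ SU(2)^E`
(continuity on the compact configuration space). [folklore] -/
theorem exists_bound_sum_hsForm_driftLie_one (L : ℕ) [NeZero L] :
    ∃ C₁ : ℝ, 0 ≤ C₁ ∧ ∀ V : GaugeConfig 3 L (Matrix.specialUnitaryGroup (Fin 2) ℂ),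
      ∑ e, hsForm (fundamentalLatticeRep 2).N
        ((fundamentalLatticeRep 2).driftLie 1 (matrixConfig (fundamentalLatticeRep 2).ρ V) e)
        ((fundamentalLatticeRep 2).driftLie 1 (matrixConfig (fundamentalLatticeRep 2).ρ V) e) ≤ C₁ := by
  haveI : Nonempty (GaugeConfig 3 L (Matrix.specialUnitaryGroup (Fin 2) ℂ)) := ⟨fun _ => 1⟩
  have hcont : Continuous fun V : GaugeConfig 3 L (Matrix.specialUnitaryGroup (Fin 2) ℂ) =>
      ∑ e, hsForm (fundamentalLatticeRep 2).N
        ((fundamentalLatticeRep 2).driftLie 1 (matrixConfig (fundamentalLatticeRep 2).ρ V) e)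
        ((fundamentalLatticeRep 2).driftLie 1 (matrixConfig (fundamentalLatticeRep 2).ρ V) e) := by
    refine continuous_finsetSum _ fun e _ => ?_
    have h := continuous_driftLie_matrixConfig (L := L) 1 e
    simp only [hsForm_apply]
    exact Complex.continuous_re.comp ((h.matrix_mul h.matrix_conjTranspose).matrix_trace)
  obtain ⟨V₀, -, hV₀⟩ := isCompact_univ.exists_isMaxOn Set.univ_nonempty hcont.continuousOn
  exact ⟨_, sum_nonneg fun e _ => hsForm_self_nonneg _, fun V => isMaxOn_iff.1 hV₀ V (Set.mem_univ V)⟩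

/-! ## Pathwise synchronous coupling in the coupling constant -/

/-- ★★ **Pathwise synchronous coupling in the coupling constant.**  For couplings `β true, β false` there are
`K = K(L, β true) > 0` and `C = C(L, β) ≥ 0` such that for every probability space with a flat Brownian motion, every pair of
regular solution families `U true` (coupling `β true`), `U false` (coupling `β false`) of the SZZ dynamics driven by the SAME
noise and every common start `x`: almost surely, for ALL `t ≥ 0`,
`Σ_e ‖ρ(U true x t)_e − ρ(U false x t)_e‖_F² ≤ C · (β true − β false)² · (e^{Kt} − 1)`. [folklore] -/
theorem synchronous_coupling_beta_hsDist_le (L : ℕ) [NeZero L] (β : Bool → ℝ) :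
    ∃ K C : ℝ, 0 < K ∧ 0 ≤ C ∧ ∀ {Ω : Type} [MeasurableSpace Ω] {P : Measure Ω} [IsProbabilityMeasure P]
      {W : ℝ≥0 → Ω → (Edge 3 L × NoiseIdx 2 → ℝ)} (hW : IsFlatBrownian W P)
      (U : Bool → GaugeConfig 3 L (Matrix.specialUnitaryGroup (Fin 2) ℂ) → ℝ≥0 → Ω →
        GaugeConfig 3 L (Matrix.specialUnitaryGroup (Fin 2) ℂ))
      (_hU : ∀ s x, (∀ ω, U s x 0 ω = x) ∧
        (latticeLangevinDynamics (fundamentalLatticeRep 2) (β s)).IsSolution (fundamentalRep (Fin 2)) hW.natFiltration P W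
          (U s x))
      (_hUm : ∀ (s : Bool) (i : ℝ≥0), Measurable[@Prod.instMeasurableSpace (Set.Iic i)
          (GaugeConfig 3 L (Matrix.specialUnitaryGroup (Fin 2) ℂ) × Ω) inferInstance
          (@Prod.instMeasurableSpace (GaugeConfig 3 L (Matrix.specialUnitaryGroup (Fin 2) ℂ)) Ω inferInstance
            (hW.natFiltration i))]
        (fun q : Set.Iic i × (GaugeConfig 3 L (Matrix.specialUnitaryGroup (Fin 2) ℂ) × Ω) => U s q.2.1 q.1 q.2.2))
      (x : GaugeConfig 3 L (Matrix.specialUnitaryGroup (Fin 2) ℂ)),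
      ∀ᵐ ω ∂P, ∀ t : ℝ≥0,
        ∑ e, hsForm (fundamentalLatticeRep 2).N
          ((fundamentalLatticeRep 2).ρ (U true x t ω e) - (fundamentalLatticeRep 2).ρ (U false x t ω e))
          ((fundamentalLatticeRep 2).ρ (U true x t ω e) - (fundamentalLatticeRep 2).ρ (U false x t ω e)) ≤
        C * (β true - β false) ^ 2 * (Real.exp (K * t) - 1) := by
  obtain ⟨K₀, hK₀, hLip⟩ := exists_lipschitz_driftDiff L (β true)
  obtain ⟨C₁, hC₁, hC₁b⟩ := exists_bound_sum_hsForm_driftLie_one L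
  have hKpos : 0 < 1 + 2 * K₀ := by positivity
  refine ⟨1 + 2 * K₀, 2 * C₁ / (1 + 2 * K₀), hKpos, by positivity, fun {Ω} _ {P} _ {W} hW U hU hUm x => ?_⟩
  set r2 := fundamentalLatticeRep 2 with hr2
  have hρu : ∀ g : Matrix.specialUnitaryGroup (Fin 2) ℂ, r2.ρ g ∈ Matrix.unitaryGroup (Fin r2.N) ℂ := r2.mem_unitary
  -- the conjugation identity for the pair `(U false x, U true x)` (same start, two couplings), all links/entries/parts
  have hid : ∀ (e : Edge 3 L) (k l : Fin r2.N) (c : Bool), ∀ᵐ ω ∂P, ∀ t : ℝ≥0,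
      (fun z : ℂ => if c then z.im else z.re) (((r2.ρ (U false x t ω e))ᴴ * r2.ρ (U true x t ω e)) k l) =
      (fun z : ℂ => if c then z.im else z.re) (((r2.ρ (x e))ᴴ * r2.ρ (x e)) k l) +
      ∫ r in Set.Ioc (0 : ℝ) t, (fun z : ℂ => if c then z.im else z.re)
        (((r2.ρ (U false x r.toNNReal ω e))ᴴ *
          (r2.driftLie (β true) (matrixConfig r2.ρ (U true x r.toNNReal ω)) e -
            r2.driftLie (β false) (matrixConfig r2.ρ (U false x r.toNNReal ω)) e) *
          r2.ρ (U true x r.toNNReal ω e)) k l) := fun e k l c =>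
    reIm_conjProduct_pair_eq_add_integral L β hW U hU hUm (fun _ => x) e k l c
  have hall : ∀ᵐ ω ∂P, ∀ (e : Edge 3 L) (k l : Fin r2.N) (c : Bool) (t : ℝ≥0),
      (fun z : ℂ => if c then z.im else z.re) (((r2.ρ (U false x t ω e))ᴴ * r2.ρ (U true x t ω e)) k l) =
      (fun z : ℂ => if c then z.im else z.re) (((r2.ρ (x e))ᴴ * r2.ρ (x e)) k l) +
      ∫ r in Set.Ioc (0 : ℝ) t, (fun z : ℂ => if c then z.im else z.re)
        (((r2.ρ (U false x r.toNNReal ω e))ᴴ *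
          (r2.driftLie (β true) (matrixConfig r2.ρ (U true x r.toNNReal ω)) e -
            r2.driftLie (β false) (matrixConfig r2.ρ (U false x r.toNNReal ω)) e) *
          r2.ρ (U true x r.toNNReal ω e)) k l) :=
    ae_all_iff.2 fun e => ae_all_iff.2 fun k => ae_all_iff.2 fun l => ae_all_iff.2 fun c => hid e k l c
  filter_upwards [hall, (hU true x).2.continuous, (hU false x).2.continuous] with ω hω hcx hcy t
  -- continuity of the integrand matrix `A_e(r)` along the path
  have hQc : ∀ (s : Bool) (e : Edge 3 L),
      Continuous (fun u : ℝ≥0 => U s x u ω) → Continuous fun r : ℝ => r2.ρ (U s x r.toNNReal ω e) := fun s e hc =>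
    r2.continuous.comp ((continuous_apply e).comp (hc.comp continuous_real_toNNReal))
  have hAc : ∀ e : Edge 3 L, Continuous fun r : ℝ => (r2.ρ (U false x r.toNNReal ω e))ᴴ *
      (r2.driftLie (β true) (matrixConfig r2.ρ (U true x r.toNNReal ω)) e -
        r2.driftLie (β false) (matrixConfig r2.ρ (U false x r.toNNReal ω)) e) *
      r2.ρ (U true x r.toNNReal ω e) := by
    intro e
    have hD : Continuous fun r : ℝ => r2.driftLie (β true) (matrixConfig r2.ρ (U true x r.toNNReal ω)) e -
        r2.driftLie (β false) (matrixConfig r2.ρ (U false x r.toNNReal ω)) e :=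
      ((continuous_driftLie_matrixConfig (β true) e).comp (hcx.comp continuous_real_toNNReal)).sub
        ((continuous_driftLie_matrixConfig (β false) e).comp (hcy.comp continuous_real_toNNReal))
    exact ((hQc false e hcy).matrix_conjTranspose.matrix_mul hD).matrix_mul (hQc true e hcx)
  -- real coordinates: `rI c`, the integrand `a`, the initial value `v0`, the primitive `w`, the target `δ`
  set rI : Bool → ℂ → ℝ := fun c z => if c then z.im else z.re with hrI
  have hrI_cont : ∀ c, Continuous (rI c) := by
    intro c; cases c
    · exact Complex.continuous_re
    · exact Complex.continuous_im
  have hrI_sub : ∀ c (z z' : ℂ), rI c (z - z') = rI c z - rI c z' := by intro c z z'; cases c <;> simp [hrI]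
  have hsum_bool_sq : ∀ z : ℂ, ∑ c : Bool, rI c z ^ 2 = z.re * z.re + z.im * z.im := by
    intro z; rw [Fintype.sum_bool]; simp [hrI]; ring
  have hsum_bool_mul : ∀ z z' : ℂ, ∑ c : Bool, rI c z * rI c z' = z.re * z'.re + z.im * z'.im := by
    intro z z'; rw [Fintype.sum_bool]; simp [hrI]; ring
  set A : Edge 3 L → ℝ → Matrix (Fin r2.N) (Fin r2.N) ℂ := fun e r => (r2.ρ (U false x r.toNNReal ω e))ᴴ *
      (r2.driftLie (β true) (matrixConfig r2.ρ (U true x r.toNNReal ω)) e -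
        r2.driftLie (β false) (matrixConfig r2.ρ (U false x r.toNNReal ω)) e) *
      r2.ρ (U true x r.toNNReal ω e) with hA
  set a : Edge 3 L → Fin r2.N → Fin r2.N → Bool → ℝ → ℝ := fun e k l c r => rI c (A e r k l) with ha
  have ha_cont : ∀ e k l c, Continuous (a e k l c) := fun e k l c =>
    (hrI_cont c).comp ((continuous_apply l).comp ((continuous_apply k).comp (hAc e)))
  set v0 : Edge 3 L → Fin r2.N → Fin r2.N → Bool → ℝ := fun e k l c => rI c (((r2.ρ (x e))ᴴ * r2.ρ (x e)) k l)
    with hv0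
  set w : Edge 3 L → Fin r2.N → Fin r2.N → Bool → ℝ → ℝ := fun e k l c u => v0 e k l c + ∫ r in (0 : ℝ)..u, a e k l c r
    with hw
  set δ : Fin r2.N → Fin r2.N → Bool → ℝ := fun k l c => rI c ((1 : Matrix (Fin r2.N) (Fin r2.N) ℂ) k l) with hδ
  set Ψ : ℝ → ℝ := fun u => ∑ e, ∑ k, ∑ l, ∑ c, (w e k l c u - δ k l c) ^ 2 with hΨ
  set Ψ' : ℝ → ℝ := fun u => ∑ e, ∑ k, ∑ l, ∑ c, 2 * (w e k l c u - δ k l c) * a e k l c u with hΨ'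
  -- derivative of `Ψ`
  have hw_deriv : ∀ e k l c u, HasDerivAt (w e k l c) (a e k l c u) u := by
    intro e k l c u
    have h := ((ha_cont e k l c).integral_hasStrictDerivAt 0 u).hasDerivAt
    exact h.const_add _
  have hΨ_deriv : ∀ u, HasDerivAt Ψ (Ψ' u) u := by
    intro u
    simp only [hΨ, hΨ']
    refine HasDerivAt.fun_sum fun e _ => HasDerivAt.fun_sum fun k _ => HasDerivAt.fun_sum fun l _ =>
      HasDerivAt.fun_sum fun c _ => ?_
    have h := ((hw_deriv e k l c u).sub_const (δ k l c)).pow 2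
    refine h.congr_deriv ?_
    norm_num
  have hΨ_cont : Continuous Ψ := continuous_iff_continuousAt.2 fun u => (hΨ_deriv u).continuousAt
  -- at nonnegative times `w = Re/Im V` coordinates, `Ψ = Σ_e ‖ρU¹_e − ρU⁰_e‖²`, `|Ψ'| ≤ (1 + 2K₀) Ψ + 2C₁Δ²`
  have hw_eq : ∀ (e : Edge 3 L) (k l : Fin r2.N) (c : Bool) (s : ℝ≥0),
      w e k l c s = rI c (((r2.ρ (U false x s ω e))ᴴ * r2.ρ (U true x s ω e)) k l) := by
    intro e k l c s
    have h := hω e k l c s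
    simp only [hw, hv0, ha, hA]
    rw [intervalIntegral.integral_of_le s.coe_nonneg]
    exact h.symm
  have hV1 : ∀ (e : Edge 3 L) (s : ℝ≥0), (r2.ρ (U false x s ω e))ᴴ * r2.ρ (U true x s ω e) - 1 =
      (r2.ρ (U false x s ω e))ᴴ * (r2.ρ (U true x s ω e) - r2.ρ (U false x s ω e)) := by
    intro e s
    have hu : (r2.ρ (U false x s ω e))ᴴ * r2.ρ (U false x s ω e) = 1 := by
      rw [← Matrix.star_eq_conjTranspose]; exact Matrix.mem_unitaryGroup_iff'.1 (hρu (U false x s ω e))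
    rw [Matrix.mul_sub, hu]
  have hWW : ∀ (e : Edge 3 L) (s : ℝ≥0), ((r2.ρ (U false x s ω e))ᴴ)ᴴ * (r2.ρ (U false x s ω e))ᴴ = 1 := by
    intro e s
    rw [Matrix.conjTranspose_conjTranspose, ← Matrix.star_eq_conjTranspose]
    exact Matrix.mem_unitaryGroup_iff.1 (hρu (U false x s ω e))
  have hQu : ∀ (e : Edge 3 L) (s : ℝ≥0), r2.ρ (U true x s ω e) * (r2.ρ (U true x s ω e))ᴴ = 1 := by
    intro e s
    rw [← Matrix.star_eq_conjTranspose]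
    exact Matrix.mem_unitaryGroup_iff.1 (hρu (U true x s ω e))
  have hΨ_eq : ∀ s : ℝ≥0, Ψ s = ∑ e, hsForm r2.N (r2.ρ (U true x s ω e) - r2.ρ (U false x s ω e))
      (r2.ρ (U true x s ω e) - r2.ρ (U false x s ω e)) := by
    intro s
    simp only [hΨ]
    refine sum_congr rfl fun e _ => ?_
    rw [← hsForm_mul_left_of_conjTranspose_mul_eq_one (hWW e s), ← hV1 e s, hsForm_eq_sum_re_im]
    refine sum_congr rfl fun k _ => sum_congr rfl fun l _ => ?_
    have hwd : ∀ c, w e k l c s - δ k l c = rI c ((((r2.ρ (U false x s ω e))ᴴ * r2.ρ (U true x s ω e)) - 1) k l) := by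
      intro c; rw [hw_eq, hδ, Matrix.sub_apply, hrI_sub]
    simp_rw [hwd]
    rw [hsum_bool_sq]
  have hΨ'_eq : ∀ s : ℝ≥0, Ψ' s = ∑ e, 2 * hsForm r2.N ((r2.ρ (U false x s ω e))ᴴ * r2.ρ (U true x s ω e) - 1) (A e s) := by
    intro s
    simp only [hΨ']
    refine sum_congr rfl fun e _ => ?_
    rw [hsForm_eq_sum_re_im, mul_sum]
    refine sum_congr rfl fun k _ => ?_
    rw [mul_sum]
    refine sum_congr rfl fun l _ => ?_
    have hwd : ∀ c, w e k l c s - δ k l c = rI c ((((r2.ρ (U false x s ω e))ᴴ * r2.ρ (U true x s ω e)) - 1) k l) := by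
      intro c; rw [hw_eq, hδ, Matrix.sub_apply, hrI_sub]
    have : ∑ c : Bool, 2 * (w e k l c s - δ k l c) * a e k l c s =
        2 * ∑ c : Bool, rI c ((((r2.ρ (U false x s ω e))ᴴ * r2.ρ (U true x s ω e)) - 1) k l) * rI c (A e s k l) := by
      rw [mul_sum]; refine sum_congr rfl fun c _ => ?_; rw [hwd]; simp only [ha]; ring
    rw [this, hsum_bool_mul]
  have hΨ_nonneg : ∀ u, 0 ≤ Ψ u := fun u =>
    sum_nonneg fun _ _ => sum_nonneg fun _ _ => sum_nonneg fun _ _ => sum_nonneg fun _ _ => sq_nonneg _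
  have hΨ'_bd : ∀ s : ℝ≥0, |Ψ' s| ≤ (1 + 2 * K₀) * Ψ s + 2 * C₁ * (β true - β false) ^ 2 := by
    intro s
    rw [hΨ'_eq]
    have h1 : |∑ e, 2 * hsForm r2.N ((r2.ρ (U false x s ω e))ᴴ * r2.ρ (U true x s ω e) - 1) (A e s)| ≤
        ∑ e, (hsForm r2.N ((r2.ρ (U false x s ω e))ᴴ * r2.ρ (U true x s ω e) - 1)
            ((r2.ρ (U false x s ω e))ᴴ * r2.ρ (U true x s ω e) - 1) + hsForm r2.N (A e s) (A e s)) := by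
      refine (abs_sum_le_sum_abs _ _).trans (sum_le_sum fun e _ => ?_)
      rw [abs_mul, abs_two]
      exact two_mul_abs_hsForm_le _ _
    have h2 : ∑ e, hsForm r2.N ((r2.ρ (U false x s ω e))ᴴ * r2.ρ (U true x s ω e) - 1)
        ((r2.ρ (U false x s ω e))ᴴ * r2.ρ (U true x s ω e) - 1) = Ψ s := by
      rw [hΨ_eq]
      refine sum_congr rfl fun e _ => ?_
      rw [hV1, hsForm_mul_left_of_conjTranspose_mul_eq_one (hWW e s)]
    -- the new step: split `D_{β₁}(U¹) − D_{β₂}(U⁰)` into the configuration part and the `β`-part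
    have h3 : ∑ e, hsForm r2.N (A e s) (A e s) ≤ 2 * K₀ * Ψ s + 2 * C₁ * (β true - β false) ^ 2 := by
      have hAe : ∀ e, hsForm r2.N (A e s) (A e s) = hsForm r2.N
          ((r2.driftLie (β true) (matrixConfig r2.ρ (U true x s ω)) e -
              r2.driftLie (β false) (matrixConfig r2.ρ (U false x s ω)) e) * r2.ρ (U true x s ω e))
          ((r2.driftLie (β true) (matrixConfig r2.ρ (U true x s ω)) e -
              r2.driftLie (β false) (matrixConfig r2.ρ (U false x s ω)) e) * r2.ρ (U true x s ω e)) := by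
        intro e
        simp only [hA, Real.toNNReal_coe, Matrix.mul_assoc]
        exact hsForm_mul_left_of_conjTranspose_mul_eq_one (hWW e s) _
      have hsplit : ∀ e, (r2.driftLie (β true) (matrixConfig r2.ρ (U true x s ω)) e -
            r2.driftLie (β false) (matrixConfig r2.ρ (U false x s ω)) e) * r2.ρ (U true x s ω e) =
          (r2.driftLie (β true) (matrixConfig r2.ρ (U true x s ω)) e -
              r2.driftLie (β true) (matrixConfig r2.ρ (U false x s ω)) e) * r2.ρ (U true x s ω e) +
            (β true - β false) • (r2.driftLie 1 (matrixConfig r2.ρ (U false x s ω)) e * r2.ρ (U true x s ω e)) := by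
        intro e
        rw [← Matrix.smul_mul, ← driftLie_sub_driftLie, ← Matrix.add_mul, sub_add_sub_cancel]
      have hterm : ∀ e, hsForm r2.N (A e s) (A e s) ≤
          2 * hsForm r2.N
            ((r2.driftLie (β true) (matrixConfig r2.ρ (U true x s ω)) e -
                r2.driftLie (β true) (matrixConfig r2.ρ (U false x s ω)) e) * r2.ρ (U true x s ω e))
            ((r2.driftLie (β true) (matrixConfig r2.ρ (U true x s ω)) e -
                r2.driftLie (β true) (matrixConfig r2.ρ (U false x s ω)) e) * r2.ρ (U true x s ω e)) +
          2 * ((β true - β false) ^ 2 * hsForm r2.N (r2.driftLie 1 (matrixConfig r2.ρ (U false x s ω)) e)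
            (r2.driftLie 1 (matrixConfig r2.ρ (U false x s ω)) e)) := by
        intro e
        rw [hAe e, hsplit e]
        refine (hsForm_add_self_le _ _).trans (le_of_eq ?_)
        rw [hsForm_real_smul_left, hsForm_real_smul_right,
          hsForm_mul_right_of_mul_conjTranspose_eq_one (hQu e s) (r2.driftLie 1 (matrixConfig r2.ρ (U false x s ω)) e)]
        ring
      calc ∑ e, hsForm r2.N (A e s) (A e s)
          ≤ ∑ e, (2 * hsForm r2.N
            ((r2.driftLie (β true) (matrixConfig r2.ρ (U true x s ω)) e -
                r2.driftLie (β true) (matrixConfig r2.ρ (U false x s ω)) e) * r2.ρ (U true x s ω e))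
            ((r2.driftLie (β true) (matrixConfig r2.ρ (U true x s ω)) e -
                r2.driftLie (β true) (matrixConfig r2.ρ (U false x s ω)) e) * r2.ρ (U true x s ω e)) +
          2 * ((β true - β false) ^ 2 * hsForm r2.N (r2.driftLie 1 (matrixConfig r2.ρ (U false x s ω)) e)
            (r2.driftLie 1 (matrixConfig r2.ρ (U false x s ω)) e))) := sum_le_sum fun e _ => hterm e
        _ = 2 * ∑ e, hsForm r2.N
            ((r2.driftLie (β true) (matrixConfig r2.ρ (U true x s ω)) e -
                r2.driftLie (β true) (matrixConfig r2.ρ (U false x s ω)) e) * r2.ρ (U true x s ω e))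
            ((r2.driftLie (β true) (matrixConfig r2.ρ (U true x s ω)) e -
                r2.driftLie (β true) (matrixConfig r2.ρ (U false x s ω)) e) * r2.ρ (U true x s ω e)) +
          2 * ((β true - β false) ^ 2 * ∑ e, hsForm r2.N (r2.driftLie 1 (matrixConfig r2.ρ (U false x s ω)) e)
            (r2.driftLie 1 (matrixConfig r2.ρ (U false x s ω)) e)) := by
          rw [sum_add_distrib, ← mul_sum, ← mul_sum, ← mul_sum]
        _ ≤ 2 * (K₀ * Ψ s) + 2 * ((β true - β false) ^ 2 * C₁) := by
          have hL := hLip (U true x s ω) (U false x s ω)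
          rw [← hΨ_eq s] at hL
          have hB := hC₁b (U false x s ω)
          gcongr
        _ = 2 * K₀ * Ψ s + 2 * C₁ * (β true - β false) ^ 2 := by ring
    rw [sum_add_distrib, h2] at h1
    calc |∑ e, 2 * hsForm r2.N ((r2.ρ (U false x s ω e))ᴴ * r2.ρ (U true x s ω e) - 1) (A e s)|
        ≤ Ψ s + ∑ e, hsForm r2.N (A e s) (A e s) := h1
      _ ≤ Ψ s + (2 * K₀ * Ψ s + 2 * C₁ * (β true - β false) ^ 2) := by linarith
      _ = (1 + 2 * K₀) * Ψ s + 2 * C₁ * (β true - β false) ^ 2 := by ring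
  -- Grönwall on `[0, t]` with `Ψ 0 = 0`
  have h0 : Ψ 0 = 0 := by
    have h := hΨ_eq 0
    simp only [NNReal.coe_zero, (hU true x).1 ω, (hU false x).1 ω, sub_self] at h
    rw [h]
    simp
  have hG := norm_le_gronwallBound_of_norm_deriv_right_le (f := Ψ) (f' := Ψ') (δ := 0) (K := 1 + 2 * K₀)
    (ε := 2 * C₁ * (β true - β false) ^ 2) (a := 0) (b := t) hΨ_cont.continuousOn
    (fun u _ => (hΨ_deriv u).hasDerivWithinAt)
    (by rw [h0, norm_zero])
    (fun u hu => by
      have h := hΨ'_bd u.toNNReal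
      rw [Real.coe_toNNReal _ hu.1] at h
      rw [Real.norm_eq_abs, Real.norm_eq_abs, abs_of_nonneg (hΨ_nonneg u)]
      exact h)
    t ⟨t.coe_nonneg, le_rfl⟩
  rw [gronwallBound_of_K_ne_0 hKpos.ne', Real.norm_eq_abs, abs_of_nonneg (hΨ_nonneg _)] at hG
  simp only [sub_zero, zero_mul, zero_add] at hG
  -- translate back
  rw [← hΨ_eq t]
  calc Ψ t ≤ 2 * C₁ * (β true - β false) ^ 2 / (1 + 2 * K₀) * (Real.exp ((1 + 2 * K₀) * t) - 1) := hG
    _ = 2 * C₁ / (1 + 2 * K₀) * (β true - β false) ^ 2 * (Real.exp ((1 + 2 * K₀) * t) - 1) := by ring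

end Summit.QuantumFields.YangMills.Theorems.ColdStartUniversality

end
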